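import Summits.RiemannHypothesis.RiemannHypothesis.Theses.LiDirichletAsymptotic
import HarnessLib

/-!
# RiemannHypothesis / LiDirichletAsymptotic — item `Assembly`: the six χ-lemmas give the Dirichlet Li law (RH-FREE)

RH-FREE, GRH-FREE [rh-li-prover].  Route `Theses/LiDirichletAsymptotic.lean` (rung L-P(P1⁺χ), cell `pub/rh-li`), item
`Assembly` (stmt-RiemannHypothesis-19634): `LiBoxTwoSidedChar → LiSmoothMainTermChar → LiOscillatoryChar → LiBudgetChar →
LiLowZerosChar → LiFarTailsChar → LiDirichletAsymptoticLaw` — the ζ assembly (`liAsymptotic_assembly_proof`, item 19166)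
transposed.  At every height `T' ≥ max(T, n²)` the box partial sum `charLiPartialRe χ n T'` is within
`charErrFar + charErrLow + charErrSmooth + charErrOsc ≤ C √n log(qn)` of `charLiMainTerm q n`, plus the TOP boundary
term `(n²/(2T'²))·rem(q, T') ≤ 301 q n²/T'` of the oscillatory lemma; letting `T' → ∞`
(`LiDirichlet.tendsto_re_liPartialSum`: the box partial sums converge to `Re λ_χ(n)`, RH-free) kills the top term.
Nothing here bears on the truth of RH or GRH.
-/

noncomputable section

-- D-0017: `Summit.<S>.<S>.…` is the designed namespace of a single-problem summit.
set_option linter.dupNamespace false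

open MeasureTheory intervalIntegral Filter
open scoped Topology

namespace Summit.RiemannHypothesis.RiemannHypothesis.Theorems.LiTheory

open Literature.NumberTheory.LFunctions Literature.NumberTheory.LFunctions.DirichletTheta
open Summit.RiemannHypothesis.RiemannHypothesis.Theses.LiDirichletAsymptotic

namespace DirichletAssembly

/-- `log x ≤ x` crude growth: `argSRem q t ≤ 602 q t` for `q ≥ 1`, `t ≥ 1`. -/
theorem argSRem_le {q : ℕ} (hq : 1 ≤ q) {t : ℝ} (ht : 1 ≤ t) : argSRem q t ≤ 602 * q * t := by
  have hq' : (1 : ℝ) ≤ q := by exact_mod_cast hq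
  unfold argSRem
  have hpos : 0 < 9.1902 * (q : ℝ) * (t + 4) := by positivity
  have hlog : Real.log (9.1902 * q * (t + 4)) ≤ 9.1902 * q * (t + 4) := Real.log_le_self hpos.le
  nlinarith [mul_nonneg (by linarith : (0 : ℝ) ≤ q) (by linarith : (0 : ℝ) ≤ t)]

/-- `bmorRem q t ≤ 7 q t` for `q ≥ 2`, `t ≥ 1000`. -/
theorem bmorRem_le {q : ℕ} (hq : 2 ≤ q) {t : ℝ} (ht : 1000 ≤ t) : bmorRem q t ≤ 7 * q * t := by
  have hq' : (2 : ℝ) ≤ q := by exact_mod_cast hq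
  have hπ := Real.pi_pos
  have hπ4 := Real.pi_lt_four
  unfold bmorRem
  set ℓ := bmorEll q t with hℓ
  have hx : 1 < (q : ℝ) * (t + 2) / (2 * Real.pi) := by
    rw [lt_div_iff₀ (by positivity)]; nlinarith
  have hℓ0 : 0 < ℓ := by rw [hℓ, bmorEll]; exact Real.log_pos hx
  have hℓ1 : ℓ ≤ 3 * q * t := by
    rw [hℓ, bmorEll]
    refine (Real.log_le_self (by positivity)).trans ?_
    rw [div_le_iff₀ (by positivity)]
    have hq0 : (0 : ℝ) ≤ q := by positivity
    have h1 : (q : ℝ) * (t + 2) ≤ 3 * q * t := by nlinarith [mul_nonneg hq0 (by linarith : (0 : ℝ) ≤ t - 1)]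
    have h2 : 3 * (q : ℝ) * t ≤ 3 * q * t * (2 * Real.pi) := by
      have h0 : (0 : ℝ) ≤ 3 * q * t := by positivity
      have h3 : (1 : ℝ) ≤ 2 * Real.pi := by linarith [Real.pi_gt_three]
      nlinarith [mul_le_mul_of_nonneg_left h3 h0]
    exact h1.trans h2
  have hlog : Real.log (1 + ℓ) ≤ ℓ := by
    have := Real.log_le_sub_one_of_pos (by linarith : (0 : ℝ) < 1 + ℓ); linarith
  nlinarith

/-- The top-term majorant tends to `0`. -/
theorem tendsto_top (K : ℝ) : Tendsto (fun T' : ℝ ↦ K / T') atTop (𝓝 0) :=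
  tendsto_const_nhds.div_atTop tendsto_id

end DirichletAssembly

open DirichletAssembly in
/-- **Item `Assembly` of route `LiDirichletAsymptotic` — PROVED** (stmt-RiemannHypothesis-19634; RH-free, GRH-free
bookkeeping: triangle inequality at height `T'`, then `T' → ∞`). -/
theorem liDirichletAsymptotic_assembly_proof :
    Summit.RiemannHypothesis.RiemannHypothesis.Theses.LiDirichletAsymptotic.Assembly := by
  intro h1 h2 h3 h4 h5 h6 q _ χ hχ hq T hT hRH n hnc
  have hq2 : 2 ≤ q := hq
  have hq1 : 1 ≤ q := le_trans (by norm_num) hq2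
  have hqR : (2 : ℝ) ≤ q := by exact_mod_cast hq2
  have hT4 : (4 : ℝ) ≤ T := by linarith
  have hnc' : (n : ℝ) ≤ T ^ 2 / 4 := by linarith
  have hn0 : (0 : ℝ) ≤ n := Nat.cast_nonneg n
  -- generic assembly
  have main : ∀ (EO EL Cc : ℝ) (rem : ℝ → ℝ), 900 ≤ n →
      (∀ T' : ℝ, (n : ℝ) ^ 2 ≤ T' →
        |(charWeightTrace χ n T' - charWeightTrace χ n (Real.sqrt n))
          - 2 / Real.pi * (∫ t in Real.sqrt n..T', liWindowWeight n t * charGammaDensity χ t)|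
          ≤ EO + (n : ℝ) ^ 2 / (2 * T' ^ 2) * rem T') →
      |charWeightTrace χ n (Real.sqrt n) - charCountMainExact χ (Real.sqrt n)| ≤ EL →
      charErrFar q n T + EL + charErrSmooth q n + EO ≤ Cc →
      (∀ T' : ℝ, 1000 ≤ T' → rem T' ≤ 602 * q * T') →
      |LiDirichlet.liCoeffCharRe χ n - charLiMainTerm q n| ≤ Cc := by
    intro EO EL Cc rem hn900 hS hlow hbudget hrem
    have hn100 : 100 ≤ n := le_trans (by norm_num) hn900
    have hnR : (900 : ℝ) ≤ n := by exact_mod_cast hn900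
    -- pointwise bound for every large T'
    have hpt : ∀ T' : ℝ, max T ((n : ℝ) ^ 2) ≤ T' →
        |charLiPartialRe χ n T' - charLiMainTerm q n| ≤ Cc + 301 * q * (n : ℝ) ^ 2 / T' := by
      intro T' hT'
      have hTT' : T ≤ T' := le_trans (le_max_left _ _) hT'
      have hnT' : (n : ℝ) ^ 2 ≤ T' := le_trans (le_max_right _ _) hT'
      have hT'1000 : 1000 ≤ T' := hT.trans hTT'
      have hT'0 : 0 < T' := by linarith
      -- K1χ + S2χ
      have hbox := h1 q χ hχ hq n T T' hRH hT4 hTT' hnc'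
      obtain ⟨ht3, ht4⟩ := h6 q χ hχ hq T T' hT hTT'
      have hfar : 2.82 * (n : ℝ) ^ 2 * charInvMomentTail χ 4 T T' + (n : ℝ) / 2 * charInvMomentTail χ 3 T T'
          ≤ charErrFar q n T := by
        unfold charErrFar
        have e1 := mul_le_mul_of_nonneg_left ht4 (by positivity : (0 : ℝ) ≤ 2.82 * (n : ℝ) ^ 2)
        have e2 := mul_le_mul_of_nonneg_left ht3 (by positivity : (0 : ℝ) ≤ (n : ℝ) / 2)
        linarith
      -- K3χ, K2χ, S1χ
      have hosc := hS T' hnT'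
      have hsm := h2 q χ hχ hq n T' hn100 hnT'
      -- the top term
      have htop : (n : ℝ) ^ 2 / (2 * T' ^ 2) * rem T' ≤ 301 * q * (n : ℝ) ^ 2 / T' := by
        have hr := hrem T' hT'1000
        calc (n : ℝ) ^ 2 / (2 * T' ^ 2) * rem T' ≤ (n : ℝ) ^ 2 / (2 * T' ^ 2) * (602 * q * T') :=
              mul_le_mul_of_nonneg_left hr (by positivity)
          _ = 301 * q * (n : ℝ) ^ 2 / T' := by field_simp; ring
      -- triangle
      set P := charLiPartialRe χ n T'
      set W := charWeightTrace χ n T'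
      set W0 := charWeightTrace χ n (Real.sqrt n)
      set I := 2 / Real.pi * (∫ t in Real.sqrt n..T', liWindowWeight n t * charGammaDensity χ t)
      set M := charLiMainTerm q n
      set L := charCountMainExact χ (Real.sqrt n)
      have e1 := abs_le.1 (le_trans hbox hfar)
      have e2 := abs_le.1 hosc
      have e3 := abs_le.1 hsm
      have e4 := abs_le.1 hlow
      rw [abs_le]
      constructor <;> linarith
    -- pass to the limit T' → ∞
    have hlim : Tendsto (charLiPartialRe χ n) atTop (𝓝 (LiDirichlet.liCoeffCharRe χ n)) :=
      LiDirichlet.tendsto_re_liPartialSum hχ hq n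
    have habs : Tendsto (fun T' : ℝ ↦ |charLiPartialRe χ n T' - charLiMainTerm q n|) atTop
        (𝓝 |LiDirichlet.liCoeffCharRe χ n - charLiMainTerm q n|) :=
      (continuous_abs.tendsto _).comp (hlim.sub_const _)
    have hrhs : Tendsto (fun T' : ℝ ↦ Cc + 301 * q * (n : ℝ) ^ 2 / T') atTop (𝓝 (Cc + 0)) := by
      refine tendsto_const_nhds.add ?_
      have := tendsto_top (301 * q * (n : ℝ) ^ 2)
      simpa using this
    rw [add_zero] at hrhs
    exact le_of_tendsto_of_tendsto habs hrhs (Filter.eventually_atTop.2 ⟨max T ((n : ℝ) ^ 2), hpt⟩)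
  refine ⟨fun hn4 ↦ ?_, fun hb hn900 ↦ ?_⟩
  · have hn900 : 900 ≤ n := le_trans (by norm_num) hn4
    exact main (charErrOscP q n) (charErrLowP q n) (15 * Real.sqrt n * Real.log (q * n)) (argSRem q) hn900
      (fun T' hT' ↦ (h3 q χ hχ hq n T' hT').1 hn4) ((h5 q χ hχ hq n hn900).1) ((h4 q hq2 n T hT hnc).1 hn4)
      (fun T' hT' ↦ argSRem_le hq1 (by linarith))
  · exact main (charErrOscB q n) (charErrLowB q n) (Real.sqrt n * Real.log (q * n)) (bmorRem q) hn900
      (fun T' hT' ↦ (h3 q χ hχ hq n T' hT').2 hb hn900) ((h5 q χ hχ hq n hn900).2 hb) ((h4 q hq2 n T hT hnc).2 hn900)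
      (fun T' hT' ↦ (bmorRem_le hq2 hT').trans (by
        have : (0 : ℝ) ≤ q * T' := by positivity
        nlinarith))

end Summit.RiemannHypothesis.RiemannHypothesis.Theorems.LiTheory
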